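import Summits.BirchSwinnertonDyer.BirchSwinnertonDyer.Theorems.AdditiveRankOneHalvesOfFlatInclusions
import HarnessLib

/-!
# BSD_p in analytic rank ONE at ANY odd additive prime on the rows WITHOUT `ℚ_p`-rational `p`-torsion (`E(ℚ_p)[p] = 0`),
# reduction type and residual image ARBITRARY: control is the `t_p = 0` K1 door, so `BSD_p(E)` ⟸ the ♭-IMC equality + the
# rank-zero twist + print, and the r = 1 LOWER half ⟸ the Eisenstein ♭-inclusion + the twist's r = 0 UPPER half + print

Prover seat `bsd-potss-kmc`, gen 20 (cell `bsd-potss`; K9 19200 `WildRankOne` / KT 19984 `TameRankOne` — here their X3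
(reducible) rows with `t_p = 0`, which the irreducible-row kernels of `…AdditivePotSupersingularRankOneBSDpOfFacts.lean` do not
reach), 2026-08-27. HONEST FRAMING: CONDITIONAL on every displayed hypothesis; 0 definitions, 0 named facts minted, 0 `sorry`;
closes nothing; BSD_p for no curve.

The `t_p = 0` door of route K1 (`SchneiderFreeAdditiveX3.additiveControlOnTreeAt_of_facts_of_noPTorsionPadic`, re-exported as
`AdditivePotSupersingularControl.additiveControlOnTreeAt_of_facts_of_noPTorsionPadic'`) gives exact anticyclotomic control at an
odd additive prime for EVERY curve with `E(ℚ_p)[p] = 0` — no potentially-supersingular, no image, no `E(K)[p]` hypothesis, FIVE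
named facts (Poitou–Tate ×2, local Euler–Poincaré, cd ≤ 2, Brink Thm 2). Feeding it to gen 20's row-local kernels:

* **`bsdp_addv_noLocalPTorsion_of_flatIMCEq_of_twist_of_facts`** `(p) (hp2) (R)` — on the rows `R W`, `Addv W p`, `E(ℚ_p)[p] = 0`,
  `r_an = 1`: `BSD_p(W)` ⟸ Hsieh ∧ LZZ ∧ ToricPublishedInputs ∧ the five facts ∧ `hEq` (♭-IMC equality on the rows) ∧ `hTw`
  (`BSD_p` of the rank-zero twists of the rows);
* **`missingLowerBoundAt_addv_noLocalPTorsion_of_flatEisenstein_of_twistUpper_of_facts`** — same rows: the r = 1 LOWER half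
  ⟸ the Eisenstein ♭-inclusion on the rows ∧ the r = 0 UPPER half of the rows' twists ∧ the same print;
* `missingPPartAt_addv_noLocalPTorsion_…` — the first in the residuals' currency.

References: [JetchevSkinnerWan2017] §7.4.1, Thm. 3.3.1; [Hsieh2014] Thm A; [LiuZhangZhang2018] Thm 1.5.1/1.5.3; [MilneADT2006] I 2.8,
4.10; [Brink2007] Thm 2; [GrossZagier1986] I.(6.3); [FriedbergHoffstein1995] Thm. B.
-/

noncomputable section

open scoped Classical

set_option linter.dupNamespace false
set_option autoImplicit false

namespace Summit.BirchSwinnertonDyer.BirchSwinnertonDyer.Theorems.UniversalToricDescentWaldspurgerFlat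

open WeierstrassCurve NumberField IsDedekindDomain Field PowerSeries
  Literature.NumberTheory.EllipticCurves
  Literature.NumberTheory.EllipticCurves.ModularForms
  Literature.NumberTheory.EllipticCurves.Rank1Residual
  Literature.NumberTheory.EllipticCurves.Rank1Residual.Typed
  Literature.NumberTheory.EllipticCurves.KrizLi2019
  Literature.NumberTheory.GaloisRepresentations
  Literature.NumberTheory.GaloisCohomology
  Summit.BirchSwinnertonDyer.Rank1Residual
  Summit.BirchSwinnertonDyer.Rank1Residual.Additive
  Summit.BirchSwinnertonDyer.Rank1Residual.X11b
  Summit.BirchSwinnertonDyer.Rank1Residual.X11b.AcSelmer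
  Summit.BirchSwinnertonDyer.Rank1Residual.X11b.Halves
  Summit.BirchSwinnertonDyer.Rank1Residual.X11b.CongruenceLimit
  Summit.BirchSwinnertonDyer.BirchSwinnertonDyer.Theses.UniversalToricDescent
  Summit.BirchSwinnertonDyer.BirchSwinnertonDyer.Theorems.AdditivePotSupersingularControl

section NoLocal

variable (p : ℕ) [Fact p.Prime] (hp2 : p ≠ 2) (R : WeierstrassCurve ℚ → Prop)

include hp2

/-- **`BSD_p` in analytic rank one at ANY odd additive prime on the rows with `E(ℚ_p)[p] = 0`, local step discharged by the
`t_p = 0` K1 door.** For any row predicate `R`: on `R W`, `Addv W p`, `∀ Q ∈ E(ℚ_p), p•Q = 0 → Q = 0`, `r_an = 1`: `BSD_p(W)` ⟸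
Hsieh 2014 Thm A ∧ Liu–Zhang–Zhang 2018 ∧ ToricPublishedInputs ∧ {Poitou–Tate ×2, local Euler–Poincaré, cd ≤ 2, Brink Thm 2} ∧
`hEq` (the ♭-(∅,0)-IMC equality at every Heegner datum and frame of a row — RESEARCH) ∧ `hTw` (`BSD_p` of globally minimal models
of the rank-zero twists of rows). No reduction-type, image or potentially-supersingular hypothesis. CONDITIONAL; closes nothing.
[cite: JetchevSkinnerWan2017, §7.4.1 and Thm. 3.3.1 (arXiv:1512.06894)] [cite: Hsieh2014, Thm. A p. 712 (Doc. Math. 19)]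
[cite: LiuZhangZhang2018, Thm 1.5.1 and Thm 1.5.3 (Duke Math. J. 167 pp. 748–749)] [cite: MilneADT2006, Ch. I, Thm. 4.10 and Thm. 2.8]
[cite: Brink2007, Thm. 2] -/
theorem bsdp_addv_noLocalPTorsion_of_flatIMCEq_of_twist_of_facts
    (hA : Hsieh2014.thmA_exists_isHsiehLFunction_unrPeriod_anyLevel)
    (hL : LiuZhangZhang2018.thm151_thm153_modularCurve_heegnerVector_additive)
    (hF : ToricPublishedInputs)
    (hPT : ∀ (K : Type) [Field K] [NumberField K], poitouTate_selmerStructure_duality K)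
    (hPT2 : ∀ (K : Type) [Field K] [NumberField K], poitouTate_sha_tateDual K)
    (hEP : ∀ (K : Type) [Field K] [NumberField K] (v : HeightOneSpectrum (𝓞 K)),
      localEulerPoincareCharacteristic (v.adicCompletion K))
    (hcd : fieldCdLE_two_of_numberField)
    (hBr : ∀ (K : Type) [Field K] [NumberField K] (p : ℕ) [Fact p.Prime],
      ZpExtension.decomp_not_le_kerSubgroup_of_isAnticyclotomic K p)
    (hEq : ∀ (W : WeierstrassCurve ℚ) [W.IsElliptic] [W.IsGloballyMinimal] (N : ℕ) [NeZero N] (K : Type) [Field K]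
      [NumberField K] (Dt : ModularParametrizationData W N),
      R W → Addv W p → (∀ Q : (W.baseChange ℚ_[p]).toAffine.Point, p • Q = 0 → Q = 0) → W.analyticRank = 1 →
      W.conductorNorm ℤ = N → IsImaginaryQuadratic K → SatisfiesHeegnerHypothesis N K →
      ∀ (κ : ZpExtension K p), κ.IsAnticyclotomic → ∀ (γ : Field.absoluteGaloisGroup K) [Fact (κ.IsTopGenerator γ)]
        (𝔭 : HeightOneSpectrum (𝓞 K)), ((p : ℕ) : 𝓞 K) ∈ 𝔭.asIdeal → 𝔭.asIdeal.ramificationIdx (𝓞 ℚ) = 1 →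
        𝔭.asIdeal.inertiaDeg (𝓞 ℚ) = 1 → ∀ (𝔭' : HeightOneSpectrum (𝓞 K)), ((p : ℕ) : 𝓞 K) ∈ 𝔭'.asIdeal → 𝔭' ≠ 𝔭 →
        ∀ (ι' : PadicAlgCl p ≃+* ℂ), SchneiderFree.BranchInducesPrime p ι' 𝔭 →
        ∀ (ΩK : ℂ) (Ωp : ℂ_[p]) (Q : PowerSeries (PadicComplexInt p)), ΩK ≠ 0 → Ωp ≠ 0 →
          R1.IsBDPLFunctionInt p ι' 𝔭 κ γ Dt.f ΩK Ωp Q →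
          (XAc.charIdeal (W.baseChange K) p κ 𝔭' ∅ γ).map (PowerSeries.map (R1.toCpInt p)) = Ideal.span {Q})
    (hTw : ∀ (W : WeierstrassCurve ℚ) [W.IsElliptic] [W.IsGloballyMinimal] (N : ℕ) [NeZero N] (K : Type) [Field K]
      [NumberField K] (Wd : WeierstrassCurve ℚ) [Wd.IsElliptic] [Wd.IsGloballyMinimal],
      R W → Addv W p → (∀ Q : (W.baseChange ℚ_[p]).toAffine.Point, p • Q = 0 → Q = 0) → W.analyticRank = 1 →
      W.conductorNorm ℤ = N → IsImaginaryQuadratic K → SatisfiesHeegnerHypothesis N K →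
      (∃ C : VariableChange ℚ, C • W.quadraticTwist (NumberField.discr K : ℚ) = Wd) →
      (W.quadraticTwist (NumberField.discr K : ℚ)).entireLFunction 1 ≠ 0 → BSDp Wd p) :
    ∀ (W : WeierstrassCurve ℚ) [W.IsElliptic] [W.IsGloballyMinimal],
      R W → Addv W p → (∀ Q : (W.baseChange ℚ_[p]).toAffine.Point, p • Q = 0 → Q = 0) → W.analyticRank = 1 → BSDp W p := by
  intro W _ _ hR haddv hiv hr
  have hp : p.Prime := Fact.out
  exact bsdp_of_flatIMCEq_of_control_of_twist_row p hp2 hA hL hF W haddv hr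
    (fun N _ K _ _ Dt hN hK hHN κ hκ γ _ 𝔭 h𝔭 he hf 𝔭' h𝔭' hne ι' hind ΩK Ωp Q hΩK hΩp hBDP ↦
      hEq W N K Dt hR haddv hiv hr hN hK hHN κ hκ γ 𝔭 h𝔭 he hf 𝔭' h𝔭' hne ι' hind ΩK Ωp Q hΩK hΩp hBDP)
    (fun N _ K _ _ Dt H ι P hN hK hHN _hLt hP hnt hKo κ hκ γ _ 𝔭 h𝔭 he hf ↦ by
      have hpN : p ∣ W.conductorNorm ℤ :=
        (W.dvd_conductorNorm_iff_not_hasGoodReductionAtPrime p).mpr (not_good_of_addv W p haddv)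
      have hsplit : SplitsIn K p := SchneiderFreeAdditiveX3.splitsIn_of_satisfiesHeegnerHypothesis hN hHN hpN
      obtain ⟨hrank, hSha⟩ := hKo hK hHN ⟨Dt, H, ι, hP⟩ hnt
      exact additiveControlOnTreeAt_of_facts_of_noPTorsionPadic' hPT hPT2 hEP hcd hBr W p hp2 haddv hiv K hK hsplit κ hκ γ 𝔭
        h𝔭 he hf hrank hSha P hnt)
    (fun N _ K _ _ Wd _ _ hN hK hHN hC hLt ↦ hTw W N K Wd hR haddv hiv hr hN hK hHN hC hLt)

/-- **The same in the residuals' currency `MissingPPartAt W p`** (`Ш(E/ℚ)` finite by GZK). CONDITIONAL; closes nothing.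
[cite: JetchevSkinnerWan2017, §7.4.1 (arXiv:1512.06894 p. 30)] [cite: Brink2007, Thm. 2] -/
theorem missingPPartAt_addv_noLocalPTorsion_of_flatIMCEq_of_twist_of_facts
    (hA : Hsieh2014.thmA_exists_isHsiehLFunction_unrPeriod_anyLevel)
    (hL : LiuZhangZhang2018.thm151_thm153_modularCurve_heegnerVector_additive)
    (hF : ToricPublishedInputs)
    (hPT : ∀ (K : Type) [Field K] [NumberField K], poitouTate_selmerStructure_duality K)
    (hPT2 : ∀ (K : Type) [Field K] [NumberField K], poitouTate_sha_tateDual K)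
    (hEP : ∀ (K : Type) [Field K] [NumberField K] (v : HeightOneSpectrum (𝓞 K)),
      localEulerPoincareCharacteristic (v.adicCompletion K))
    (hcd : fieldCdLE_two_of_numberField)
    (hBr : ∀ (K : Type) [Field K] [NumberField K] (p : ℕ) [Fact p.Prime],
      ZpExtension.decomp_not_le_kerSubgroup_of_isAnticyclotomic K p)
    (hEq : ∀ (W : WeierstrassCurve ℚ) [W.IsElliptic] [W.IsGloballyMinimal] (N : ℕ) [NeZero N] (K : Type) [Field K]
      [NumberField K] (Dt : ModularParametrizationData W N),
      R W → Addv W p → (∀ Q : (W.baseChange ℚ_[p]).toAffine.Point, p • Q = 0 → Q = 0) → W.analyticRank = 1 →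
      W.conductorNorm ℤ = N → IsImaginaryQuadratic K → SatisfiesHeegnerHypothesis N K →
      ∀ (κ : ZpExtension K p), κ.IsAnticyclotomic → ∀ (γ : Field.absoluteGaloisGroup K) [Fact (κ.IsTopGenerator γ)]
        (𝔭 : HeightOneSpectrum (𝓞 K)), ((p : ℕ) : 𝓞 K) ∈ 𝔭.asIdeal → 𝔭.asIdeal.ramificationIdx (𝓞 ℚ) = 1 →
        𝔭.asIdeal.inertiaDeg (𝓞 ℚ) = 1 → ∀ (𝔭' : HeightOneSpectrum (𝓞 K)), ((p : ℕ) : 𝓞 K) ∈ 𝔭'.asIdeal → 𝔭' ≠ 𝔭 →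
        ∀ (ι' : PadicAlgCl p ≃+* ℂ), SchneiderFree.BranchInducesPrime p ι' 𝔭 →
        ∀ (ΩK : ℂ) (Ωp : ℂ_[p]) (Q : PowerSeries (PadicComplexInt p)), ΩK ≠ 0 → Ωp ≠ 0 →
          R1.IsBDPLFunctionInt p ι' 𝔭 κ γ Dt.f ΩK Ωp Q →
          (XAc.charIdeal (W.baseChange K) p κ 𝔭' ∅ γ).map (PowerSeries.map (R1.toCpInt p)) = Ideal.span {Q})
    (hTw : ∀ (W : WeierstrassCurve ℚ) [W.IsElliptic] [W.IsGloballyMinimal] (N : ℕ) [NeZero N] (K : Type) [Field K]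
      [NumberField K] (Wd : WeierstrassCurve ℚ) [Wd.IsElliptic] [Wd.IsGloballyMinimal],
      R W → Addv W p → (∀ Q : (W.baseChange ℚ_[p]).toAffine.Point, p • Q = 0 → Q = 0) → W.analyticRank = 1 →
      W.conductorNorm ℤ = N → IsImaginaryQuadratic K → SatisfiesHeegnerHypothesis N K →
      (∃ C : VariableChange ℚ, C • W.quadraticTwist (NumberField.discr K : ℚ) = Wd) →
      (W.quadraticTwist (NumberField.discr K : ℚ)).entireLFunction 1 ≠ 0 → BSDp Wd p) :
    ∀ (W : WeierstrassCurve ℚ) [W.IsElliptic] [W.IsGloballyMinimal],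
      R W → Addv W p → (∀ Q : (W.baseChange ℚ_[p]).toAffine.Point, p • Q = 0 → Q = 0) → W.analyticRank = 1 →
        MissingPPartAt W p := by
  intro W _ _ hR haddv hiv hr
  have hGZK : rank_eq_analyticRank_of_analyticRank_le_one := hF.2.2.1
  haveI : Finite W.sha := (hGZK W (by omega)).2
  exact missingPPartAt_of_bsdp W p
    (bsdp_addv_noLocalPTorsion_of_flatIMCEq_of_twist_of_facts p hp2 R hA hL hF hPT hPT2 hEP hcd hBr hEq hTw W hR haddv hiv hr)

/-- **The r = 1 LOWER half at ANY odd additive prime on the rows with `E(ℚ_p)[p] = 0` from the EISENSTEIN ♭-inclusion and the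
twists' r = 0 UPPER half, local step discharged by the `t_p = 0` K1 door.** Rows `R W`, `Addv W p`, `E(ℚ_p)[p] = 0`, `r_an = 1`:
`MissingLowerBoundAt W p` ⟸ Hsieh ∧ LZZ ∧ ToricPublishedInputs ∧ the five facts ∧ `hIncl` (X on the rows) ∧ `hTwUp`
(`MissingUpperBoundAt` of globally minimal models of the rank-zero twists of rows). CONDITIONAL; closes nothing.
[cite: JetchevSkinnerWan2017, §7.4.1 and Thm. 3.3.1 (arXiv:1512.06894)] [cite: Hsieh2014, Thm. A p. 712 (Doc. Math. 19)]
[cite: LiuZhangZhang2018, Thm 1.5.1 and Thm 1.5.3 (Duke Math. J. 167 pp. 748–749)] [cite: Brink2007, Thm. 2] [cite: GrossZagier1986, I.(6.3)] -/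
theorem missingLowerBoundAt_addv_noLocalPTorsion_of_flatEisenstein_of_twistUpper_of_facts
    (hA : Hsieh2014.thmA_exists_isHsiehLFunction_unrPeriod_anyLevel)
    (hL : LiuZhangZhang2018.thm151_thm153_modularCurve_heegnerVector_additive)
    (hF : ToricPublishedInputs)
    (hPT : ∀ (K : Type) [Field K] [NumberField K], poitouTate_selmerStructure_duality K)
    (hPT2 : ∀ (K : Type) [Field K] [NumberField K], poitouTate_sha_tateDual K)
    (hEP : ∀ (K : Type) [Field K] [NumberField K] (v : HeightOneSpectrum (𝓞 K)),
      localEulerPoincareCharacteristic (v.adicCompletion K))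
    (hcd : fieldCdLE_two_of_numberField)
    (hBr : ∀ (K : Type) [Field K] [NumberField K] (p : ℕ) [Fact p.Prime],
      ZpExtension.decomp_not_le_kerSubgroup_of_isAnticyclotomic K p)
    (hIncl : ∀ (W : WeierstrassCurve ℚ) [W.IsElliptic] [W.IsGloballyMinimal] (N : ℕ) [NeZero N] (K : Type) [Field K]
      [NumberField K] (Dt : ModularParametrizationData W N),
      R W → Addv W p → (∀ Q : (W.baseChange ℚ_[p]).toAffine.Point, p • Q = 0 → Q = 0) → W.analyticRank = 1 →
      W.conductorNorm ℤ = N → IsImaginaryQuadratic K → SatisfiesHeegnerHypothesis N K →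
      ∀ (κ : ZpExtension K p), κ.IsAnticyclotomic → ∀ (γ : Field.absoluteGaloisGroup K) [Fact (κ.IsTopGenerator γ)]
        (𝔭 : HeightOneSpectrum (𝓞 K)), ((p : ℕ) : 𝓞 K) ∈ 𝔭.asIdeal → 𝔭.asIdeal.ramificationIdx (𝓞 ℚ) = 1 →
        𝔭.asIdeal.inertiaDeg (𝓞 ℚ) = 1 → ∀ (𝔭' : HeightOneSpectrum (𝓞 K)), ((p : ℕ) : 𝓞 K) ∈ 𝔭'.asIdeal → 𝔭' ≠ 𝔭 →
        ∀ (ι' : PadicAlgCl p ≃+* ℂ), SchneiderFree.BranchInducesPrime p ι' 𝔭 →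
        ∀ (ΩK : ℂ) (Ωp : ℂ_[p]) (Q : PowerSeries (PadicComplexInt p)), ΩK ≠ 0 → Ωp ≠ 0 →
          R1.IsBDPLFunctionInt p ι' 𝔭 κ γ Dt.f ΩK Ωp Q →
          (XAc.charIdeal (W.baseChange K) p κ 𝔭' ∅ γ).map (PowerSeries.map (R1.toCpInt p)) ≤ Ideal.span {Q})
    (hTwUp : ∀ (W : WeierstrassCurve ℚ) [W.IsElliptic] [W.IsGloballyMinimal] (N : ℕ) [NeZero N] (K : Type) [Field K]
      [NumberField K] (Wd : WeierstrassCurve ℚ) [Wd.IsElliptic] [Wd.IsGloballyMinimal],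
      R W → Addv W p → (∀ Q : (W.baseChange ℚ_[p]).toAffine.Point, p • Q = 0 → Q = 0) → W.analyticRank = 1 →
      W.conductorNorm ℤ = N → IsImaginaryQuadratic K → SatisfiesHeegnerHypothesis N K →
      (∃ C : VariableChange ℚ, C • W.quadraticTwist (NumberField.discr K : ℚ) = Wd) →
      (W.quadraticTwist (NumberField.discr K : ℚ)).entireLFunction 1 ≠ 0 → MissingUpperBoundAt Wd p) :
    ∀ (W : WeierstrassCurve ℚ) [W.IsElliptic] [W.IsGloballyMinimal],
      R W → Addv W p → (∀ Q : (W.baseChange ℚ_[p]).toAffine.Point, p • Q = 0 → Q = 0) → W.analyticRank = 1 →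
        MissingLowerBoundAt W p := by
  intro W _ _ hR haddv hiv hr
  have hp : p.Prime := Fact.out
  exact missingLowerBoundAt_of_flatEisenstein_of_control_of_twistUpper_row p hp2 hA hL hF W haddv hr
    (fun N _ K _ _ Dt hN hK hHN κ hκ γ _ 𝔭 h𝔭 he hf 𝔭' h𝔭' hne ι' hind ΩK Ωp Q hΩK hΩp hBDP ↦
      hIncl W N K Dt hR haddv hiv hr hN hK hHN κ hκ γ 𝔭 h𝔭 he hf 𝔭' h𝔭' hne ι' hind ΩK Ωp Q hΩK hΩp hBDP)
    (fun N _ K _ _ Dt H ι P hN hK hHN _hLt hP hnt hKo κ hκ γ _ 𝔭 h𝔭 he hf ↦ by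
      have hpN : p ∣ W.conductorNorm ℤ :=
        (W.dvd_conductorNorm_iff_not_hasGoodReductionAtPrime p).mpr (not_good_of_addv W p haddv)
      have hsplit : SplitsIn K p := SchneiderFreeAdditiveX3.splitsIn_of_satisfiesHeegnerHypothesis hN hHN hpN
      obtain ⟨hrank, hSha⟩ := hKo hK hHN ⟨Dt, H, ι, hP⟩ hnt
      exact additiveControlOnTreeAt_of_facts_of_noPTorsionPadic' hPT hPT2 hEP hcd hBr W p hp2 haddv hiv K hK hsplit κ hκ γ 𝔭
        h𝔭 he hf hrank hSha P hnt)
    (fun N _ K _ _ Wd _ _ hN hK hHN hC hLt ↦ hTwUp W N K Wd hR haddv hiv hr hN hK hHN hC hLt)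

end NoLocal

end Summit.BirchSwinnertonDyer.BirchSwinnertonDyer.Theorems.UniversalToricDescentWaldspurgerFlat

end
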